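import Summits.NavierStokesRegularity.NavierStokesRegularity.Theorems.ArgmaxDoorsDepletion
import HarnessLib

/-!
# ArgmaxNearDoorsSplit — door family S36 (nsreg-p1 ROUND-34): plates «CoreSplit» (§7) and D♯ «NearFarSplit» (§B),
# PROVED (δ-unfolded; by-name wrappers follow P0-36)

S-door lane (ns-sfl-p1 g5, first-announce 2026-08-28T17:10:49Z; LEAD ns-s30-p1 g3; texts of record nsreg-p1 g30
`r34/Sketch36.lean` sha16 f0fe6d26e287c4b8, `CoreSplit` l.638 and `NearFarSplit` l.821;
`--supports stmt-NavierStokesRegularity-0056 --as helper`).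

Splitting the depletion integral `∫ G`, `G(y) = |ω(y) − ⟪ω(y),ξ(x)⟫ξ(x)| |x−y|⁻³` (`ξ(x) = ω(x)/|ω(x)|`), of a frame
slice at a point `x` under a local LIPSCHITZ bound `|ω(y) − ω(x)| ≤ Λ|y − x|` on `B(x,r)`:

* `setIntegral_ball_depletion_le` — the CORE: `∫_{B(x,r)} G ≤ 4πrΛ` (the projection orthogonal to `ξ(x)` kills
  `ω(x)`, so `G ≤ Λ|x−y|⁻²` on the ball; `∫_{|z|<r}|z|⁻² = 4πr`, the tree's `integral_kernelMajorant`);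
* `coreSplit` — plate «CoreSplit» verbatim (δ-unfolded): `∫_{B(x,r₂)} G ≤ 4πr₁Λ + ∫_{B(x,r₂)∖B(x,r₁)} G`;
* `nearFarSplit` — plate D♯ «NearFarSplit» verbatim (δ-unfolded): `∫ G ≤ 4πrΛ + ∫_{B(x,r)ᶜ} G`;
* `frame_vorticity_slice` — the frame's vorticity slices are `C¹` with `∫‖ω‖² < ∞` (so `G` is integrable by
  `integrable_depletionIntegrand`).

WHAT THIS IS NOT: measure-theoretic bookkeeping for regularity CRITERIA (doors S36-C𝔞 / S36-K) about hypothetical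
blow-up; item 0056 `NoTypeII` and NS regularity are NOT proved; nothing here is a route or a summit statement.
-/

-- the summit's problem namespace repeats the summit name (tree layout)
set_option linter.dupNamespace false

noncomputable section

open MeasureTheory Set Function Filter Metric Real InnerProductSpace
open scoped ENNReal NNReal RealInnerProductSpace Topology ContDiff

namespace Summit.NavierStokesRegularity.NavierStokesRegularity.Theorems.ArgmaxDoors

open Literature.Analysis Literature.Analysis.FluidPDE

/-! ### The core under a Lipschitz bound -/

/-- **The core of the depletion integral under a Lipschitz bound.** For `ω ∈ C¹` with `∫‖ω‖² < ∞`, a point `x`,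
`r > 0`, `Λ ≥ 0` and `|ω(y) − ω(x)| ≤ Λ|y − x|` on `B(x,r)`:
`∫_{B(x,r)} |ω(y) − ⟪ω(y),ξ⟫ξ| |x−y|⁻³ dy ≤ 4πrΛ`, `ξ = vorticityDirection ω x`. -/
theorem setIntegral_ball_depletion_le {w : EuclideanSpace ℝ (Fin 3) → EuclideanSpace ℝ (Fin 3)}
    (hw : ContDiff ℝ 1 w) (hw2 : Integrable fun y => ‖w y‖ ^ 2) (x : EuclideanSpace ℝ (Fin 3))
    {r Λ : ℝ} (hr : 0 < r) (hΛ : 0 ≤ Λ) (hLip : ∀ y, ‖y - x‖ < r → ‖w y - w x‖ ≤ Λ * ‖y - x‖) :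
    ∫ y in ball x r, ‖w y - ⟪w y, vorticityDirection w x⟫ • vorticityDirection w x‖ * (‖x - y‖ ^ 3)⁻¹ ≤
      4 * π * r * Λ := by
  have he1 : ‖vorticityDirection w x‖ ≤ 1 := by
    by_cases hx : w x = 0
    · rw [(vorticityDirection_eq_zero_iff w x).2 hx, norm_zero]; exact zero_le_one
    · exact (norm_vorticityDirection w hx).le
  have h0 : w x - ⟪w x, vorticityDirection w x⟫ • vorticityDirection w x = 0 :=
    self_sub_inner_vorticityDirection_smul w x
  -- pointwise on the ball: `G ≤ Λ |x − y|⁻²`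
  have hpt : ∀ y ∈ ball x r,
      ‖w y - ⟪w y, vorticityDirection w x⟫ • vorticityDirection w x‖ * (‖x - y‖ ^ 3)⁻¹ ≤
        Λ * kernelMajorant r (x - y) := by
    intro y hy
    rw [mem_ball, dist_eq_norm] at hy
    by_cases hyx : y = x
    · subst hyx
      rw [h0, norm_zero, zero_mul]
      exact mul_nonneg hΛ (kernelMajorant_nonneg _ _)
    · have hpos : 0 < ‖x - y‖ := norm_pos_iff.2 (sub_ne_zero.2 (Ne.symm hyx))
      have hmem : x - y ∈ ball (0 : EuclideanSpace ℝ (Fin 3)) r := by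
        rw [mem_ball_zero_iff, norm_sub_rev]; exact hy
      have hk : kernelMajorant r (x - y) = (‖x - y‖ ^ 2)⁻¹ := by
        rw [kernelMajorant, indicator_of_mem hmem]
      have hnum : ‖w y - ⟪w y, vorticityDirection w x⟫ • vorticityDirection w x‖ ≤ Λ * ‖x - y‖ := by
        calc ‖w y - ⟪w y, vorticityDirection w x⟫ • vorticityDirection w x‖
            = ‖(w y - ⟪w y, vorticityDirection w x⟫ • vorticityDirection w x) -
                (w x - ⟪w x, vorticityDirection w x⟫ • vorticityDirection w x)‖ := by rw [h0, sub_zero]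
          _ = ‖(w y - w x) - ⟪w y - w x, vorticityDirection w x⟫ • vorticityDirection w x‖ := by
              rw [sub_inner_smul_sub]
          _ ≤ ‖w y - w x‖ := norm_sub_inner_smul_le he1 _
          _ ≤ Λ * ‖y - x‖ := hLip y hy
          _ = Λ * ‖x - y‖ := by rw [norm_sub_rev]
      calc ‖w y - ⟪w y, vorticityDirection w x⟫ • vorticityDirection w x‖ * (‖x - y‖ ^ 3)⁻¹
          ≤ (Λ * ‖x - y‖) * (‖x - y‖ ^ 3)⁻¹ := mul_le_mul_of_nonneg_right hnum (by positivity)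
        _ = Λ * kernelMajorant r (x - y) := by rw [hk]; field_simp
  -- integrate over the ball
  have hG : Integrable fun y =>
      ‖w y - ⟪w y, vorticityDirection w x⟫ • vorticityDirection w x‖ * (‖x - y‖ ^ 3)⁻¹ :=
    integrable_depletionIntegrand hw hw2 x
  have hK : Integrable fun y => Λ * kernelMajorant r (x - y) :=
    ((integrable_kernelMajorant r).comp_sub_left x).const_mul Λ
  calc ∫ y in ball x r, ‖w y - ⟪w y, vorticityDirection w x⟫ • vorticityDirection w x‖ * (‖x - y‖ ^ 3)⁻¹
      ≤ ∫ y in ball x r, Λ * kernelMajorant r (x - y) :=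
        setIntegral_mono_on hG.integrableOn hK.integrableOn measurableSet_ball hpt
    _ ≤ ∫ y, Λ * kernelMajorant r (x - y) :=
        setIntegral_le_integral hK (Eventually.of_forall fun y =>
          mul_nonneg hΛ (kernelMajorant_nonneg _ _))
    _ = 4 * π * r * Λ := by
        rw [integral_const_mul, integral_sub_left_eq_self (kernelMajorant r) volume x,
          integral_kernelMajorant hr.le]
        ring

/-! ### The frame's vorticity slices -/

/-- In the frame, every vorticity slice `ω(t)`, `t ∈ [0,T)`, is `C¹` with `∫‖ω(t)‖² < ∞`. -/
theorem frame_vorticity_slice {ν T : ℝ} {u : ℝ → (EuclideanSpace ℝ (Fin 3)) → (EuclideanSpace ℝ (Fin 3))}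
    {p : ℝ → (EuclideanSpace ℝ (Fin 3)) → ℝ} (hsol : IsClassicalNSSolutionOn (Ico 0 T) ν 0 u p)
    (hreg : ∀ T'' < T, HasBoundedSobolevNormsOn (Icc 0 T'') u) {t : ℝ} (ht : t ∈ Ico 0 T) :
    ContDiff ℝ 1 (curl (u t)) ∧ Integrable fun y => ‖curl (u t) y‖ ^ 2 := by
  have hv : ContDiff ℝ ∞ (u t) := hsol.contDiff_velocity ht
  have hv2 : ContDiff ℝ 2 (u t) := hv.of_le (by norm_cast)
  have hω1 : ContDiff ℝ 1 (curl (u t)) := contDiff_curl (n := 1) (by exact hv2)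
  obtain ⟨C₁, hC₁⟩ := hreg t ht.2 1
  have hω2' : ∫⁻ y, ‖curl (u t) y‖ₑ ^ 2 < ⊤ :=
    lt_of_le_of_lt ((lintegral_curl_sq_le (u t)).trans (mul_le_mul' le_rfl (hC₁ t ⟨ht.1, le_rfl⟩)))
      (ENNReal.mul_lt_top ENNReal.ofReal_lt_top ENNReal.coe_lt_top)
  exact ⟨hω1, integrable_sq_norm_of_lintegral_lt_top hω1.continuous hω2'⟩

/-! ### Plate «CoreSplit» -/

/-- plate «CoreSplit» (nsreg-p1 ROUND-34 §7, `Sketch36.lean` l.638), PROVED — the text δ-unfolded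
(`nearDepletionIntegral u t x r₂ = ∫_{B(x,r₂)} G`, `annulusDepletionIntegral u t x r₁ r₂ = ∫_{B(x,r₂)∖B(x,r₁)} G`):
under `|ω(y) − ω(x)| ≤ Λ|y − x|` on `B(x,r₁)`, `∫_{B(x,r₂)} G ≤ 4πr₁Λ + ∫_{B(x,r₂)∖B(x,r₁)} G`. -/
theorem coreSplit : ∀ (ν T : ℝ) (u : ℝ → (EuclideanSpace ℝ (Fin 3)) → (EuclideanSpace ℝ (Fin 3)))
    (p : ℝ → (EuclideanSpace ℝ (Fin 3)) → ℝ),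
    IsClassicalNSSolutionOn (Ico 0 T) ν 0 u p →
    (∀ T'' < T, HasBoundedSobolevNormsOn (Icc 0 T'') u) →
    ∀ t ∈ Ico 0 T, ∀ x, curl (u t) x ≠ 0 → ∀ (r₁ r₂ Λ : ℝ), 0 < r₁ → 0 < r₂ → 0 ≤ Λ →
      (∀ y, ‖y - x‖ < r₁ → ‖curl (u t) y - curl (u t) x‖ ≤ Λ * ‖y - x‖) →
      (∫ y in ball x r₂, ‖curl (u t) y - ⟪curl (u t) y, vorticityDirection (curl (u t)) x⟫ •
          vorticityDirection (curl (u t)) x‖ * (‖x - y‖ ^ 3)⁻¹) ≤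
        4 * π * r₁ * Λ +
          ∫ y in ball x r₂ \ ball x r₁, ‖curl (u t) y - ⟪curl (u t) y, vorticityDirection (curl (u t)) x⟫ •
            vorticityDirection (curl (u t)) x‖ * (‖x - y‖ ^ 3)⁻¹ := by
  intro ν T u p hsol hreg t ht x _ r₁ r₂ Λ hr₁ _ hΛ hLip
  obtain ⟨hω1, hω2⟩ := frame_vorticity_slice hsol hreg ht
  have hG := integrable_depletionIntegrand hω1 hω2 x
  have hG0 : ∀ y, 0 ≤ ‖curl (u t) y - ⟪curl (u t) y, vorticityDirection (curl (u t)) x⟫ •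
      vorticityDirection (curl (u t)) x‖ * (‖x - y‖ ^ 3)⁻¹ := fun y => by positivity
  rw [← integral_inter_add_sdiff (μ := volume) measurableSet_ball hG.integrableOn]
  refine add_le_add ?_ le_rfl
  calc ∫ y in ball x r₂ ∩ ball x r₁, ‖curl (u t) y - ⟪curl (u t) y, vorticityDirection (curl (u t)) x⟫ •
          vorticityDirection (curl (u t)) x‖ * (‖x - y‖ ^ 3)⁻¹
      ≤ ∫ y in ball x r₁, ‖curl (u t) y - ⟪curl (u t) y, vorticityDirection (curl (u t)) x⟫ •
          vorticityDirection (curl (u t)) x‖ * (‖x - y‖ ^ 3)⁻¹ :=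
        setIntegral_mono_set hG.integrableOn (Eventually.of_forall hG0)
          (Eventually.of_forall inter_subset_right)
    _ ≤ 4 * π * r₁ * Λ := setIntegral_ball_depletion_le hω1 hω2 x hr₁ hΛ hLip

/-! ### Plate D♯ «NearFarSplit» -/

/-- plate D♯ «NearFarSplit» (nsreg-p1 ROUND-34 §B, `Sketch36.lean` l.821), PROVED — the text δ-unfolded
(`depletionIntegral u t x = ∫ G`, `farDepletionIntegral u t x r = ∫_{B(x,r)ᶜ} G`): under `|ω(y) − ω(x)| ≤ Λ|y − x|` on
`B(x,r)`, `∫ G ≤ 4πrΛ + ∫_{B(x,r)ᶜ} G`. -/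
theorem nearFarSplit : ∀ (ν T : ℝ) (u : ℝ → (EuclideanSpace ℝ (Fin 3)) → (EuclideanSpace ℝ (Fin 3)))
    (p : ℝ → (EuclideanSpace ℝ (Fin 3)) → ℝ),
    IsClassicalNSSolutionOn (Ico 0 T) ν 0 u p →
    (∀ T'' < T, HasBoundedSobolevNormsOn (Icc 0 T'') u) →
    ∀ t ∈ Ico 0 T, ∀ x, curl (u t) x ≠ 0 → ∀ (r Λ : ℝ), 0 < r → 0 ≤ Λ →
      (∀ y, ‖y - x‖ < r → ‖curl (u t) y - curl (u t) x‖ ≤ Λ * ‖y - x‖) →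
      (∫ y, ‖curl (u t) y - ⟪curl (u t) y, vorticityDirection (curl (u t)) x⟫ •
          vorticityDirection (curl (u t)) x‖ * (‖x - y‖ ^ 3)⁻¹) ≤
        4 * π * r * Λ +
          ∫ y in (ball x r)ᶜ, ‖curl (u t) y - ⟪curl (u t) y, vorticityDirection (curl (u t)) x⟫ •
            vorticityDirection (curl (u t)) x‖ * (‖x - y‖ ^ 3)⁻¹ := by
  intro ν T u p hsol hreg t ht x _ r Λ hr hΛ hLip
  obtain ⟨hω1, hω2⟩ := frame_vorticity_slice hsol hreg ht
  have hG := integrable_depletionIntegrand hω1 hω2 x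
  rw [← integral_add_compl (μ := volume) measurableSet_ball hG]
  exact add_le_add (setIntegral_ball_depletion_le hω1 hω2 x hr hΛ hLip) le_rfl

end Summit.NavierStokesRegularity.NavierStokesRegularity.Theorems.ArgmaxDoors

end
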